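import Summits.CriticalPhenomena.PercolationContinuityZ3.Theorems.Transplant.CayleyCylinderShort
import Summits.CriticalPhenomena.PercolationContinuityZ3.Theorems.Transplant.CayleyCylinderKitDir
import HarnessLib

/-!
# Cylinders of a Cayley-graph skeleton IX — the THICK frame with a box excursion

builds on p205010 (kernel theorem, internal audit signed; external expert review pending) — nothing in this file uses p205010.
Lane `prim-bschramm`, seat `prim-bschramm-p4` gen 11 (PART C3 of `P4-GENERAL.md`, "thick frames").  Helper file
(`--supports stmt-CriticalPhenomena-4575 --as helper`).

For `E : CylData₂ Γ S` (file VIII: `ker φ` generated by kernel elements of length `≤ r`), big cylinder `V_L`, `L = ℓ + 2r + 1`, and an edge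
`{x, y}` of the small cylinder `‖φ‖_∞ ≤ ℓ`, the THICK FRAME `p → c₁ → c₂ → c → c·k → · → · → q`: from the floor point `p = x s₀^{−n_A}` along
`s₁` to the corner `c₁ = (−L, L)`, along `s₀` to `c₂ = (L−r, L)`, down `s₁⁻¹` to the excursion base `c = (L−r, L−r)`, then the EXCURSION — the
kernel walk `boxWalk k` of file VIII (inside `‖φ‖_∞ ≤ r`) translated to `c`, so that its vertices have both heights in `[ℓ+1, L]` — then back
up by `s₁^{r}`, right by `s₀^{r}` to the corner `(L, L)`, and down the ceiling by `s₁⁻¹` to `q = y s₀^{n_B}`.  Every frame vertex has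
`φ₀ = ±L` or `φ₁ ≥ ℓ + 1` (`frame_mem`), so lies outside the small cylinder (`frame_out`) and off the columns of `x` and `y`; no sign, no
parity, no condition on `ℓ`.  Outputs for the cycle kit of file X: `colA`, `colB`, `pathM` and their supports, `edges_pathM`.
-/

noncomputable section

namespace Summit.CriticalPhenomena.PercolationContinuityZ3.Theorems.Transplant

namespace CayCyl

open SimpleGraph Walk Literature.Probability.LatticeModels Literature.Probability.Percolation
open scoped Classical

variable {Γ : Type} [Group Γ] {S : Finset Γ}

namespace CylData₂

variable (E : CylData₂ Γ S)

/-- The cylinder graph `H_L = Cay(Γ;S)[V_L]` (vertex set from the enlarged datum, edges from `S`). [cite: KozmaNitzan2024, §4 p. 15 (boxes)] -/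
abbrev cylG (L : ℕ) : SimpleGraph (E.enl.V L) := (mulCayley (S : Set Γ)).induce (E.enl.V L)

/-- Steps by `s₀` are edges of `Cay(Γ;S)`. [folklore] -/
theorem adjE_s₀ (g : Γ) : (mulCayley (S : Set Γ)).Adj g (g * E.enl.s₀) := adj_mul_of_mem S (t := E.enl.s₀) (Or.inl E.s₀_mem) E.enl.s₀_ne_one g
/-- Steps by `s₀⁻¹` are edges of `Cay(Γ;S)`. [folklore] -/
theorem adjE_s₀_inv (g : Γ) : (mulCayley (S : Set Γ)).Adj g (g * E.enl.s₀⁻¹) :=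
  adj_mul_of_mem S (t := E.enl.s₀⁻¹) (Or.inr (by rw [inv_inv]; exact E.s₀_mem)) (inv_ne_one.2 E.enl.s₀_ne_one) g
/-- Steps by `s₁` are edges of `Cay(Γ;S)`. [folklore] -/
theorem adjE_s₁ (g : Γ) : (mulCayley (S : Set Γ)).Adj g (g * E.enl.s₁) := adj_mul_of_mem S (t := E.enl.s₁) (Or.inl E.s₁_mem) E.enl.s₁_ne_one g
/-- Steps by `s₁⁻¹` are edges of `Cay(Γ;S)`. [folklore] -/
theorem adjE_s₁_inv (g : Γ) : (mulCayley (S : Set Γ)).Adj g (g * E.enl.s₁⁻¹) :=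
  adj_mul_of_mem S (t := E.enl.s₁⁻¹) (Or.inr (by rw [inv_inv]; exact E.s₁_mem)) (inv_ne_one.2 E.enl.s₁_ne_one) g

/-- `φ 1 = 0` for the thick datum. [folklore] -/
theorem φE_one : E.φ (1 : Γ) = 0 := E.enl.φ_one

section Kit

variable {ℓ : ℕ} (x y : E.enl.V (ℓ + 2 * E.r + 1))

/-- The run from the first corner to the excursion column: `2ℓ + 3r + 2 = 2L − r` steps. [folklore] -/
def n₀ (E : CylData₂ Γ S) (ℓ : ℕ) : ℕ := 2 * ℓ + 3 * E.r + 2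

/-- The first corner `c₁ = p s₁^{m₁}` at `(−L, L)`. [folklore] -/
abbrev c₁ : Γ := E.enl.pt x * E.enl.s₁ ^ E.enl.m₁ x

/-- The second point `c₂ = c₁ s₀^{n₀}` at `(L−r, L)`. [folklore] -/
abbrev c₂ : Γ := E.c₁ x * E.enl.s₀ ^ E.n₀ ℓ

/-- The excursion base `c = c₂ s₁^{−r}` at `(L−r, L−r)`. [folklore] -/
abbrev cc : Γ := E.c₂ x * E.enl.s₁⁻¹ ^ E.r

/-- The kernel element of the excursion: `k = c⁻¹ q s₁^{m₂} s₀^{−r} s₁^{−r}`. [folklore] -/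
def kel : Γ := (E.cc x)⁻¹ * E.enl.qt y * E.enl.s₁ ^ E.enl.m₂ y * (E.enl.s₀ ^ E.r)⁻¹ * (E.enl.s₁ ^ E.r)⁻¹

/-- The excursion end `c₃ = c k`. [folklore] -/
abbrev c₃ : Γ := E.cc x * E.kel x y

/-- The frame closes: `c₃ s₁^{r} s₀^{r} s₁^{−m₂} = q`. [folklore] -/
theorem c₃_end : E.c₃ x y * E.enl.s₁ ^ E.r * E.enl.s₀ ^ E.r * E.enl.s₁⁻¹ ^ E.enl.m₂ y = E.enl.qt y := by
  show E.cc x * ((E.cc x)⁻¹ * E.enl.qt y * E.enl.s₁ ^ E.enl.m₂ y * (E.enl.s₀ ^ E.r)⁻¹ * (E.enl.s₁ ^ E.r)⁻¹) * E.enl.s₁ ^ E.r *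
      E.enl.s₀ ^ E.r * E.enl.s₁⁻¹ ^ E.enl.m₂ y = E.enl.qt y
  rw [inv_pow E.enl.s₁ (E.enl.m₂ y)]
  simp only [mul_assoc, mul_inv_cancel_left, inv_mul_cancel_left, mul_inv_cancel, mul_one]

/-- Coordinates of `c₁`. [folklore] -/
theorem φE_c₁ : E.φ (E.c₁ x) 0 = -((ℓ : ℤ) + 2 * E.r + 1) ∧ E.φ (E.c₁ x) 1 = (ℓ : ℤ) + 2 * E.r + 1 := by
  have h := E.enl.φ_c₁ x; rw [enl_φ] at h; push_cast at h; exact h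

/-- Coordinates of `c₂`. [folklore] -/
theorem φE_c₂ : E.φ (E.c₂ x) 0 = (ℓ : ℤ) + E.r + 1 ∧ E.φ (E.c₂ x) 1 = (ℓ : ℤ) + 2 * E.r + 1 := by
  have h := E.enl.φ_s₀_pow (E.c₁ x) (E.n₀ ℓ); have hc := E.φE_c₁ x
  rw [enl_φ] at h
  refine ⟨?_, by rw [h.2, hc.2]⟩
  rw [h.1, hc.1, n₀]; push_cast; ring

/-- Coordinates of the excursion base `c`. [folklore] -/
theorem φE_cc : E.φ (E.cc x) 0 = (ℓ : ℤ) + E.r + 1 ∧ E.φ (E.cc x) 1 = (ℓ : ℤ) + E.r + 1 := by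
  have h := E.enl.φ_s₁inv_pow (E.c₂ x) E.r; have hc := E.φE_c₂ x
  rw [enl_φ] at h
  refine ⟨by rw [h.1, hc.1], ?_⟩
  rw [h.2, hc.2]; ring

/-- `k ∈ ker φ`. [folklore] -/
theorem φE_kel : E.φ (E.kel x y) = 0 := by
  have hc := E.φE_cc x
  have hq := E.enl.φ_qt y; rw [enl_φ] at hq
  have em := E.enl.m₂_eq y; rw [enl_φ] at em
  have h1 : E.φ (E.enl.s₁ ^ E.enl.m₂ y) = ((E.enl.m₂ y : ℕ) : ℤ) • (Pi.single 1 1 : Site 2) := by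
    have := E.enl.φ_pow E.enl.s₁ (E.enl.m₂ y); rwa [E.enl.φ_s₁, enl_φ] at this
  have h2 : E.φ (E.enl.s₀ ^ E.r) = (E.r : ℤ) • (Pi.single 0 1 : Site 2) := by
    have := E.enl.φ_pow E.enl.s₀ E.r; rwa [E.enl.φ_s₀, enl_φ] at this
  have h3 : E.φ (E.enl.s₁ ^ E.r) = (E.r : ℤ) • (Pi.single 1 1 : Site 2) := by
    have := E.enl.φ_pow E.enl.s₁ E.r; rwa [E.enl.φ_s₁, enl_φ] at this
  have hi : ∀ g : Γ, E.φ g⁻¹ = -E.φ g := fun g => E.φ_inv g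
  funext j
  rw [kel, E.map_mul, E.map_mul, E.map_mul, E.map_mul, hi, hi, hi, h1, h2, h3]
  fin_cases j
  · show -E.φ (E.cc x) 0 + E.φ (E.enl.qt y) 0 + (((E.enl.m₂ y : ℕ) : ℤ) • (Pi.single 1 1 : Site 2)) 0 +
        -(((E.r : ℤ) • (Pi.single 0 1 : Site 2)) 0) + -(((E.r : ℤ) • (Pi.single 1 1 : Site 2)) 0) = 0
    rw [hc.1, hq.1]; simp; ring
  · show -E.φ (E.cc x) 1 + E.φ (E.enl.qt y) 1 + (((E.enl.m₂ y : ℕ) : ℤ) • (Pi.single 1 1 : Site 2)) 1 +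
        -(((E.r : ℤ) • (Pi.single 0 1 : Site 2)) 1) + -(((E.r : ℤ) • (Pi.single 1 1 : Site 2)) 1) = 0
    rw [hc.2, hq.2]; simp; rw [em]; push_cast; ring

/-- **The excursion**: the kernel walk of `k` inside `‖φ‖_∞ ≤ r`, translated to the base `c`. [folklore] -/
def seg : (mulCayley (S : Set Γ)).Walk (E.cc x) (E.c₃ x y) :=
  (lmul S (E.cc x) (E.boxWalk (E.kel x y) (E.φE_kel x y))).copy (mul_one _) rfl

/-- The length of the excursion. [folklore] -/
theorem length_segE : (E.seg x y).length = E.boxLen (E.kel x y) := by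
  simp only [seg, Walk.length_copy, length_lmul, E.length_boxWalk]

/-- Heights along the excursion: both coordinates in `[ℓ+1, L]`. [folklore] -/
theorem φE_seg {v : Γ} (hv : v ∈ (E.seg x y).support) :
    ((ℓ : ℤ) + 1 ≤ E.φ v 0 ∧ E.φ v 0 ≤ (ℓ : ℤ) + 2 * E.r + 1) ∧ ((ℓ : ℤ) + 1 ≤ E.φ v 1 ∧ E.φ v 1 ≤ (ℓ : ℤ) + 2 * E.r + 1) := by
  rw [seg, support_copy] at hv
  obtain ⟨v', hv', rfl⟩ := mem_support_lmul.1 hv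
  have h0 := E.boxWalk_inBox _ (E.φE_kel x y) v' hv'
  rw [mem_box] at h0
  have ha := h0 0; have hb := h0 1
  have hc := E.φE_cc x
  rw [E.map_mul, Pi.add_apply, Pi.add_apply, hc.1, hc.2]
  constructor <;> constructor <;> omega

/-- **The thick frame** `p → c₁ → c₂ → c → c₃ → c₃ s₁^r → c₃ s₁^r s₀^r → q`. [folklore] -/
def frame : (mulCayley (S : Set Γ)).Walk (E.enl.pt x) (E.enl.qt y) :=
  (powWalk S E.adjE_s₁ (E.enl.pt x) (E.enl.m₁ x)).append <|
    (powWalk S E.adjE_s₀ (E.c₁ x) (E.n₀ ℓ)).append <|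
      (powWalk S E.adjE_s₁_inv (E.c₂ x) E.r).append <|
        (E.seg x y).append <|
          (powWalk S E.adjE_s₁ (E.c₃ x y) E.r).append <|
            (powWalk S E.adjE_s₀ (E.c₃ x y * E.enl.s₁ ^ E.r) E.r).append
              ((powWalk S E.adjE_s₁_inv (E.c₃ x y * E.enl.s₁ ^ E.r * E.enl.s₀ ^ E.r) (E.enl.m₂ y)).copy rfl (E.c₃_end x y))

/-- The length of the thick frame. [folklore] -/
theorem length_frameE :
    (E.frame x y).length = E.enl.m₁ x + E.n₀ ℓ + E.r + E.boxLen (E.kel x y) + E.r + E.r + E.enl.m₂ y := by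
  rw [frame, Walk.length_append, Walk.length_append, Walk.length_append, Walk.length_append, Walk.length_append,
    Walk.length_append, Walk.length_copy, length_segE, length_powWalk, length_powWalk, length_powWalk, length_powWalk,
    length_powWalk, length_powWalk]
  ring

/-- Coordinates of `c₃` (equal to those of `c`). [folklore] -/
theorem φE_c₃ : E.φ (E.c₃ x y) 0 = (ℓ : ℤ) + E.r + 1 ∧ E.φ (E.c₃ x y) 1 = (ℓ : ℤ) + E.r + 1 := by
  have hc := E.φE_cc x
  have hk := E.φE_kel x y
  have h : E.φ (E.c₃ x y) = E.φ (E.cc x) + E.φ (E.kel x y) := E.map_mul _ _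
  simp only [h, Pi.add_apply, hk, Pi.zero_apply, add_zero]
  exact hc

/-- **Every frame vertex lies in the big cylinder, and on the floor `φ₀ = −L`, on the ceiling `φ₀ = L`, or at height `φ₁ ≥ ℓ + 1`.** [folklore] -/
theorem frame_mem {v : Γ} (hv : v ∈ (E.frame x y).support) :
    v ∈ E.enl.V (ℓ + 2 * E.r + 1) ∧
      (E.φ v 0 = -((ℓ : ℤ) + 2 * E.r + 1) ∨ E.φ v 0 = (ℓ : ℤ) + 2 * E.r + 1 ∨ (ℓ : ℤ) + 1 ≤ E.φ v 1) := by
  have hx1 := (E.enl.memV.1 x.2).2; have hy1 := (E.enl.memV.1 y.2).2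
  rw [enl_φ, abs_le] at hx1 hy1
  push_cast at hx1 hy1
  rw [E.enl.memV, enl_φ, abs_le, abs_le]
  push_cast
  rw [frame] at hv
  rcases (Walk.mem_support_append_iff _ _).1 hv with hv | hv
  · obtain ⟨i, hi, rfl⟩ := (mem_support_powWalk _).1 hv
    have h := E.enl.φ_s₁_pow (E.enl.pt x) i; have hp := E.enl.φ_pt x; have e := E.enl.m₁_eq x
    rw [enl_φ] at h hp e
    push_cast at hp e
    have hi' : (i : ℤ) ≤ E.enl.m₁ x := by exact_mod_cast hi
    rw [h.1, h.2, hp.1, hp.2]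
    refine ⟨?_, Or.inl rfl⟩; omega
  rcases (Walk.mem_support_append_iff _ _).1 hv with hv | hv
  · obtain ⟨i, hi, rfl⟩ := (mem_support_powWalk _).1 hv
    have h := E.enl.φ_s₀_pow (E.c₁ x) i; have hc := E.φE_c₁ x
    rw [enl_φ] at h
    have hi' : (i : ℤ) ≤ E.n₀ ℓ := by exact_mod_cast hi
    rw [n₀] at hi'; push_cast at hi'
    rw [h.1, h.2, hc.1, hc.2]
    refine ⟨?_, Or.inr (Or.inr ?_)⟩ <;> omega
  rcases (Walk.mem_support_append_iff _ _).1 hv with hv | hv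
  · obtain ⟨i, hi, rfl⟩ := (mem_support_powWalk _).1 hv
    have h := E.enl.φ_s₁inv_pow (E.c₂ x) i; have hc := E.φE_c₂ x
    rw [enl_φ] at h
    have hi' : (i : ℤ) ≤ E.r := by exact_mod_cast hi
    rw [h.1, h.2, hc.1, hc.2]
    refine ⟨?_, Or.inr (Or.inr ?_)⟩ <;> omega
  rcases (Walk.mem_support_append_iff _ _).1 hv with hv | hv
  · have h := E.φE_seg x y hv
    refine ⟨?_, Or.inr (Or.inr h.2.1)⟩; omega
  rcases (Walk.mem_support_append_iff _ _).1 hv with hv | hv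
  · obtain ⟨i, hi, rfl⟩ := (mem_support_powWalk _).1 hv
    have h := E.enl.φ_s₁_pow (E.c₃ x y) i; have hc := E.φE_c₃ x y
    rw [enl_φ] at h
    have hi' : (i : ℤ) ≤ E.r := by exact_mod_cast hi
    rw [h.1, h.2, hc.1, hc.2]
    refine ⟨?_, Or.inr (Or.inr ?_)⟩ <;> omega
  rcases (Walk.mem_support_append_iff _ _).1 hv with hv | hv
  · obtain ⟨i, hi, rfl⟩ := (mem_support_powWalk _).1 hv
    have h := E.enl.φ_s₀_pow (E.c₃ x y * E.enl.s₁ ^ E.r) i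
    have h' := E.enl.φ_s₁_pow (E.c₃ x y) E.r; have hc := E.φE_c₃ x y
    rw [enl_φ] at h h'
    have hi' : (i : ℤ) ≤ E.r := by exact_mod_cast hi
    rw [h.1, h.2, h'.1, h'.2, hc.1, hc.2]
    refine ⟨?_, Or.inr (Or.inr ?_)⟩ <;> omega
  · rw [support_copy] at hv
    obtain ⟨i, hi, rfl⟩ := (mem_support_powWalk _).1 hv
    have h := E.enl.φ_s₁inv_pow (E.c₃ x y * E.enl.s₁ ^ E.r * E.enl.s₀ ^ E.r) i
    have h' := E.enl.φ_s₀_pow (E.c₃ x y * E.enl.s₁ ^ E.r) E.r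
    have h'' := E.enl.φ_s₁_pow (E.c₃ x y) E.r; have hc := E.φE_c₃ x y
    have e := E.enl.m₂_eq y
    rw [enl_φ] at h h' h'' e
    push_cast at e
    have hi' : (i : ℤ) ≤ E.enl.m₂ y := by exact_mod_cast hi
    rw [h.1, h.2, h'.1, h'.2, h''.1, h''.2, hc.1, hc.2]
    refine ⟨?_, Or.inr (Or.inl ?_)⟩ <;> omega

/-- **Every frame vertex lies outside the small cylinder `‖φ‖_∞ ≤ ℓ`.** [folklore] -/
theorem frame_out {v : Γ} (hv : v ∈ (E.frame x y).support) : E.φ v ∉ box 2 ℓ := by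
  have h := (E.frame_mem x y hv).2
  rw [CylData₁.mem_box_two, abs_le, abs_le]
  rcases h with h | h | h <;> omega

/-- The column of `x` stays in the big cylinder. [folklore] -/
theorem colA_memE : ∀ z ∈ (powWalk S E.adjE_s₀_inv x.1 (E.enl.nA x)).support, z ∈ E.enl.V (ℓ + 2 * E.r + 1) := by
  intro z hz
  obtain ⟨i, hi, rfl⟩ := (mem_support_powWalk _).1 hz
  have h := E.enl.φ_s₀inv_pow x.1 i; have hx := E.enl.memV.1 x.2; have e := E.enl.nA_eq x
  have hi' : (i : ℤ) ≤ E.enl.nA x := by exact_mod_cast hi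
  rw [enl_φ] at h e hx
  rw [abs_le, abs_le] at hx
  rw [E.enl.memV, enl_φ, abs_le, abs_le, h.1, h.2]; omega

/-- The column of `y` stays in the big cylinder. [folklore] -/
theorem colB_memE : ∀ z ∈ (powWalk S E.adjE_s₀ y.1 (E.enl.nB y)).support, z ∈ E.enl.V (ℓ + 2 * E.r + 1) := by
  intro z hz
  obtain ⟨i, hi, rfl⟩ := (mem_support_powWalk _).1 hz
  have h := E.enl.φ_s₀_pow y.1 i; have hy := E.enl.memV.1 y.2; have e := E.enl.nB_eq y
  have hi' : (i : ℤ) ≤ E.enl.nB y := by exact_mod_cast hi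
  rw [enl_φ] at h e hy
  rw [abs_le, abs_le] at hy
  rw [E.enl.memV, enl_φ, abs_le, abs_le, h.1, h.2]; omega

/-- **The column of `x` down to the floor**, as a walk of `H_L`. [folklore] -/
def colA : (E.cylG (ℓ + 2 * E.r + 1)).Walk x (E.enl.pV x) :=
  (powWalk S E.adjE_s₀_inv x.1 (E.enl.nA x)).induce (E.enl.V (ℓ + 2 * E.r + 1)) (E.colA_memE x)

/-- **The column of `y` up to the ceiling, reversed**, as a walk of `H_L`. [folklore] -/
def colB : (E.cylG (ℓ + 2 * E.r + 1)).Walk (E.enl.qV y) y :=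
  ((powWalk S E.adjE_s₀ y.1 (E.enl.nB y)).induce (E.enl.V (ℓ + 2 * E.r + 1)) (E.colB_memE y)).reverse

/-- **The thick frame as a simple path of `H_L`.** [folklore] -/
def pathM : (E.cylG (ℓ + 2 * E.r + 1)).Walk (E.enl.pV x) (E.enl.qV y) :=
  ((E.frame x y).induce (E.enl.V (ℓ + 2 * E.r + 1)) fun _ hz => (E.frame_mem x y hz).1).bypass

/-- Vertices of `colA` are `x s₀^{−i}`, `i ≤ nA`. [folklore] -/
theorem mem_colAE {z : E.enl.V (ℓ + 2 * E.r + 1)} (hz : z ∈ (E.colA x).support) : ∃ i, i ≤ E.enl.nA x ∧ z.1 = x.1 * E.enl.s₀⁻¹ ^ i :=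
  (mem_support_powWalk _).1 ((mem_support_induce_iff _ (E.colA_memE x) z).1 hz)

/-- Vertices of `colB` are `y s₀^{j}`, `j ≤ nB`. [folklore] -/
theorem mem_colBE {z : E.enl.V (ℓ + 2 * E.r + 1)} (hz : z ∈ (E.colB y).support) : ∃ j, j ≤ E.enl.nB y ∧ z.1 = y.1 * E.enl.s₀ ^ j := by
  have hz' := (mem_support_reverse_iff _ z).1 hz
  exact (mem_support_powWalk _).1 ((mem_support_induce_iff _ (E.colB_memE y) z).1 hz')

/-- Vertices of `pathM` are frame vertices. [folklore] -/
theorem mem_pathME {z : E.enl.V (ℓ + 2 * E.r + 1)} (hz : z ∈ (E.pathM x y).support) : z.1 ∈ (E.frame x y).support :=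
  (mem_support_induce_iff _ _ _).1 (support_bypass_subset_support _ hz)

/-- Every vertex of `pathM` lies outside the small cylinder. [folklore] -/
theorem pathM_out {z : E.enl.V (ℓ + 2 * E.r + 1)} (hz : z ∈ (E.pathM x y).support) : E.φ z.1 ∉ box 2 ℓ :=
  E.frame_out x y (E.mem_pathME x y hz)

/-- The lengths of the columns. [folklore] -/
theorem length_cols : (E.colA x).length = E.enl.nA x ∧ (E.colB y).length = E.enl.nB y :=
  ⟨(length_induce _ _).trans (length_powWalk _ _ _),
    (Walk.length_reverse _).trans ((length_induce _ _).trans (length_powWalk _ _ _))⟩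

end Kit

end CylData₂

end CayCyl

end Summit.CriticalPhenomena.PercolationContinuityZ3.Theorems.Transplant

end
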